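import Mathlib
import Summits.Ventures.PercRepro2.LocRows
import Summits.Ventures.PercRepro2.SwRow
import Summits.Ventures.PercRepro2.SwCheckMask

/-!
# Row (SW) on an explicit small graph from a kernel-checked certificate
(blind cell PercRepro2, night-4 g15, 2026-08-26; proofs/NIGHT4-G15.md §3)

On the edge-list graphs of `SwCheckMask` (configurations as bitmasks, clusters by
`clusterMask`), `inQ` decides membership in `Q = {h ∉ H_l, o ∈ R_side(l)}` (`inQ_iff`) and
`checkSw es l h o tbl` verifies a table `tbl : List ℕ` (the image of every configuration) as a
witness of row (SW): every `Q`-point is sent to a `Q`-point whose blue cluster of `h` contains its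
red cluster of `h` (`okPair`), injectively (the loop keeps the set of images used, `loop_spec`).
**`sw_of_checkSw`**: a certificate accepted by the checker gives `LocRows.Sw (endsOf es) l h o`
(every configuration is `toConfig` of a unique bitmask below `2^m`, `exists_toConfig_eq`); for a
concrete graph the certificate is then checked by `decide +kernel` — standard axioms only.
-/

namespace Summit.Ventures.PercRepro2

namespace SwCheck

open Hull LocRows

variable {n : ℕ}

/-! ## The certificate checker -/

/-- The blue configuration of `ω` on `m` edges: the bits below `m` complemented. -/
def blueMask (m ω : ℕ) : ℕ := (2 ^ m - 1) ^^^ ω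

/-- `blueMask` encodes the colour swap. -/
lemma toConfig_blueMask (m ω : ℕ) : toConfig m (blueMask m ω) = blue (toConfig m ω) := by
  funext e
  simp [toConfig, blueMask, blue, Nat.testBit_xor, Nat.testBit_two_pow_sub_one, e.isLt]

/-- Membership in `Q = {h ∉ H_l, o ∈ R_side(l)}` of the configuration `ω`. -/
def inQ (es : List (Fin n × Fin n)) (l h o : Fin n) (ω : ℕ) : Bool :=
  let R := clusterMask ω es l
  let B := clusterMask (blueMask es.length ω) es l
  !R.testBit h.val && !B.testBit h.val && R.testBit o.val && !B.testBit o.val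

/-- `inQ` decides membership in `tgtU (endsOf es) l h {S ∣ o ∈ S}`. -/
lemma inQ_iff (es : List (Fin n × Fin n)) (l h o : Fin n) (ω : ℕ) :
    inQ es l h o ω = true ↔
      toConfig es.length ω ∈ tgtU (endsOf es) l h {S : Set (Fin n) | o ∈ S} := by
  have hR : ∀ x : Fin n, (clusterMask ω es l).testBit x.val = true ↔
      x ∈ cluster (endsOf es) (toConfig es.length ω) l := clusterMask_testBit_iff ω es l
  have hB : ∀ x : Fin n, (clusterMask (blueMask es.length ω) es l).testBit x.val = true ↔
      x ∈ cluster (endsOf es) (blue (toConfig es.length ω)) l := by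
    intro x; rw [clusterMask_testBit_iff, toConfig_blueMask]
  simp only [tgtU, Finset.mem_filter, Finset.mem_univ, true_and, hull, Set.mem_union,
    Set.mem_setOf_eq, not_or, ← hR, ← hB, inQ, Bool.and_eq_true, Bool.not_eq_true',
    Bool.not_eq_true]
  tauto

/-- The checks on a source `ω` and its image `η`: `η` is a configuration of `Q` and the red cluster
of `h` at `ω` lies inside the blue cluster of `h` at `η`. -/
def okPair (es : List (Fin n × Fin n)) (l h o : Fin n) (ω η : ℕ) : Bool :=
  decide (η < 2 ^ es.length) && inQ es l h o η &&
    (clusterMask ω es h &&& ((2 ^ n - 1) ^^^ clusterMask (blueMask es.length η) es h)) == 0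

/-- What `okPair` guarantees. -/
lemma okPair_spec (es : List (Fin n × Fin n)) (l h o : Fin n) (ω η : ℕ)
    (hp : okPair es l h o ω η = true) :
    η < 2 ^ es.length ∧ toConfig es.length η ∈ tgtU (endsOf es) l h {S : Set (Fin n) | o ∈ S} ∧
      cluster (endsOf es) (toConfig es.length ω) h ⊆
        cluster (endsOf es) (blue (toConfig es.length η)) h := by
  simp only [okPair, Bool.and_eq_true, decide_eq_true_eq, beq_iff_eq] at hp
  obtain ⟨⟨hlt, hQ⟩, hland⟩ := hp
  refine ⟨hlt, (inQ_iff es l h o η).1 hQ, fun x hx => ?_⟩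
  rw [← clusterMask_testBit_iff] at hx
  rw [← toConfig_blueMask, ← clusterMask_testBit_iff]
  have hbit := congrArg (fun S => S.testBit x.val) hland
  simp only [Nat.testBit_land, Nat.testBit_xor, Nat.testBit_two_pow_sub_one, x.isLt,
    decide_true, Nat.zero_testBit, hx, Bool.true_and, Bool.true_xor] at hbit
  simpa using hbit

/-- The loop over the configurations `ζ < k` (with the set `seen` of images already used):
every `Q`-point is checked against its image and the images are pairwise distinct. -/
def loop (es : List (Fin n × Fin n)) (l h o : Fin n) (tbl : List ℕ) : ℕ → ℕ → Bool
  | 0, _ => true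
  | k + 1, seen =>
    if inQ es l h o k then
      okPair es l h o k (tbl.getD k 0) && !seen.testBit (tbl.getD k 0) &&
        loop es l h o tbl k (seen ||| 2 ^ tbl.getD k 0)
    else loop es l h o tbl k seen

/-- **The checker**: the loop over all `2^m` configurations. -/
def checkSw (es : List (Fin n × Fin n)) (l h o : Fin n) (tbl : List ℕ) : Bool :=
  loop es l h o tbl (2 ^ es.length) 0

/-- What the loop guarantees for every `Q`-point below `k`. -/
lemma loop_spec (es : List (Fin n × Fin n)) (l h o : Fin n) (tbl : List ℕ) :
    ∀ (k seen : ℕ), loop es l h o tbl k seen = true →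
      ∀ ζ, ζ < k → inQ es l h o ζ = true →
        okPair es l h o ζ (tbl.getD ζ 0) = true ∧ seen.testBit (tbl.getD ζ 0) = false ∧
          ∀ ζ', ζ' < k → ζ' ≠ ζ → inQ es l h o ζ' = true → tbl.getD ζ' 0 ≠ tbl.getD ζ 0 := by
  intro k
  induction k with
  | zero => intro seen _ ζ hζ; exact absurd hζ (Nat.not_lt_zero ζ)
  | succ k ih =>
    intro seen hl ζ hζ hQ
    simp only [loop] at hl
    by_cases hk : inQ es l h o k = true
    · rw [if_pos hk] at hl
      simp only [Bool.and_eq_true, Bool.not_eq_true'] at hl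
      obtain ⟨⟨hok, hseen⟩, hrest⟩ := hl
      have ih' := ih _ hrest
      rcases Nat.lt_succ_iff_lt_or_eq.1 hζ with hlt | rfl
      · obtain ⟨h1, h2, h3⟩ := ih' ζ hlt hQ
        refine ⟨h1, ?_, ?_⟩
        · rw [Nat.testBit_lor] at h2
          exact (Bool.or_eq_false_iff.1 h2).1
        · intro ζ' hζ' hne hQ'
          rcases Nat.lt_succ_iff_lt_or_eq.1 hζ' with hlt' | rfl
          · exact h3 ζ' hlt' hne hQ'
          · intro heq
            rw [Nat.testBit_lor, ← heq, Nat.testBit_two_pow_self] at h2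
            simp at h2
      · refine ⟨hok, hseen, ?_⟩
        intro ζ' hζ' hne hQ' heq
        have hlt' : ζ' < ζ := by
          rcases Nat.lt_succ_iff_lt_or_eq.1 hζ' with hlt' | rfl
          · exact hlt'
          · exact absurd rfl hne
        obtain ⟨_, h2, _⟩ := ih' ζ' hlt' hQ'
        rw [Nat.testBit_lor, heq, Nat.testBit_two_pow_self] at h2
        simp at h2
    · rw [if_neg hk] at hl
      have ih' := ih _ hl
      have hlt : ζ < k := by
        rcases Nat.lt_succ_iff_lt_or_eq.1 hζ with hlt | rfl
        · exact hlt
        · exact absurd hQ hk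
      obtain ⟨h1, h2, h3⟩ := ih' ζ hlt hQ
      refine ⟨h1, h2, ?_⟩
      intro ζ' hζ' hne hQ'
      rcases Nat.lt_succ_iff_lt_or_eq.1 hζ' with hlt' | rfl
      · exact h3 ζ' hlt' hne hQ'
      · exact absurd hQ' hk

/-- Every configuration on `m` edges is `toConfig` of a unique bitmask below `2^m`. -/
lemma exists_toConfig_eq (m : ℕ) (ζ : Config (Fin m)) : ∃ ω, ω < 2 ^ m ∧ toConfig m ω = ζ := by
  let g : Fin (2 ^ m) → Config (Fin m) := fun ω => toConfig m ω.val
  have hinj : Function.Injective g := by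
    intro ω ω' hωω'
    apply Fin.ext
    apply Nat.eq_of_testBit_eq
    intro i
    by_cases hi : i < m
    · exact congrFun hωω' ⟨i, hi⟩
    · rw [Nat.testBit_lt_two_pow (lt_of_lt_of_le ω.isLt (Nat.pow_le_pow_right (by omega) (by omega))),
        Nat.testBit_lt_two_pow (lt_of_lt_of_le ω'.isLt (Nat.pow_le_pow_right (by omega) (by omega)))]
  have hcard : Fintype.card (Fin (2 ^ m)) = Fintype.card (Config (Fin m)) := by
    simp [Config]
  have hbij : Function.Bijective g := (Fintype.bijective_iff_injective_and_card g).2 ⟨hinj, hcard⟩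
  obtain ⟨ω, hω⟩ := hbij.2 ζ
  exact ⟨ω.val, ω.isLt, hω⟩

/-- **Row (SW) from a certificate**: a table accepted by `checkSw` gives `LocRows.Sw (endsOf es) l h o`. -/
theorem sw_of_checkSw (es : List (Fin n × Fin n)) (l h o : Fin n) (tbl : List ℕ)
    (hc : checkSw es l h o tbl = true) : Sw (endsOf es) l h o := by
  classical
  have spec := loop_spec es l h o tbl _ _ hc
  -- the bitmask of a configuration
  let code : Config (Fin es.length) → ℕ := fun ζ => (exists_toConfig_eq es.length ζ).choose
  have hcode : ∀ ζ, code ζ < 2 ^ es.length ∧ toConfig es.length (code ζ) = ζ :=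
    fun ζ => (exists_toConfig_eq es.length ζ).choose_spec
  have hQ : ∀ x : {ζ // ζ ∈ tgtU (endsOf es) l h {S : Set (Fin n) | o ∈ S}},
      inQ es l h o (code x.1) = true := by
    intro x
    rw [inQ_iff, (hcode x.1).2]
    exact x.2
  refine ⟨fun x => toConfig es.length (tbl.getD (code x.1) 0), ?_, ?_⟩
  · intro x y hxy
    obtain ⟨hx1, _, hx3⟩ := spec (code x.1) (hcode x.1).1 (hQ x)
    obtain ⟨hy1, _, _⟩ := spec (code y.1) (hcode y.1).1 (hQ y)
    have hlt_x := (okPair_spec es l h o _ _ hx1).1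
    have hlt_y := (okPair_spec es l h o _ _ hy1).1
    -- equal images as configurations give equal bitmasks
    have heq : tbl.getD (code x.1) 0 = tbl.getD (code y.1) 0 := by
      apply Nat.eq_of_testBit_eq
      intro i
      by_cases hi : i < es.length
      · exact congrFun hxy ⟨i, hi⟩
      · rw [Nat.testBit_lt_two_pow (lt_of_lt_of_le hlt_x (Nat.pow_le_pow_right (by omega) (by omega))),
          Nat.testBit_lt_two_pow (lt_of_lt_of_le hlt_y (Nat.pow_le_pow_right (by omega) (by omega)))]
    by_contra hne
    have hne' : code y.1 ≠ code x.1 := by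
      intro h
      apply hne
      apply Subtype.ext
      rw [← (hcode x.1).2, ← (hcode y.1).2, h]
    exact hx3 (code y.1) (hcode y.1).1 hne' (hQ y) heq.symm
  · intro x
    obtain ⟨hx1, _, _⟩ := spec (code x.1) (hcode x.1).1 (hQ x)
    obtain ⟨_, hmem, hsub⟩ := okPair_spec es l h o _ _ hx1
    refine ⟨hmem, ?_⟩
    rw [(hcode x.1).2] at hsub
    exact hsub

end SwCheck

end Summit.Ventures.PercRepro2
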